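import Summits.QuantumAdvantage.QuantumAdvantage.Theorems.CharDialTransferDialE
import HarnessLib

/-!
# TransferDial F — carving the open leaf `PartnersTwoOdd` by SUBFUNCTION COUNTS: `Partners ⟸ SliceFew ∧ RainbowBound`

`PartnersTwoOdd` (part C; the one open leaf of `closes_of_PF`, part E) is a SYMMETRY statement, and symmetry is not monotone under
restriction (a restriction can only gain exchangeable pairs).  Counting SUBFUNCTIONS is monotone: `rowOf f S a` = the cut
`u ↦ f(a on S, u off S)` (the row of `a` in the communication matrix of `f` for the bipartition `(S, Sᶜ)`), `rowCount f S` = the number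
of distinct rows.  In B-world (`f = F ∘ x`, `x(u) = Σᵢ [uᵢ] λᵢ ∈ 𝔽_p^K`) the row of `a` is determined by `x_S(a)`, so `rowCount ≤ p^K` for
every `S` (`rowCount_le_of_forms`, `sliceFew_of_structureLaw`).  The carving (`partners_of_sliceFew_rainbow`, kernel):

  PartnersTwoOdd  ⟸  SliceFewTwoOdd  ∧  RainbowBound

* `SliceFewTwoOdd` (algebraic, OPEN): every cut of `𝔽_p`-degree `≤ 2p − 3` has `≤ R(p)` distinct rows for EVERY bipartition —
  equivalently (finite field) bounded `𝔽_p`-rank of every communication matrix `M_S[a,b] = f(a,b)`, i.e. of every variable-bipartition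
  flattening of the coefficient tensor; implied by B with `R = p^K`; false at degree `2p − 2` (generic quadratic character).
* `RainbowBound` (pure combinatorics, p-free, OPEN): a Boolean function with `≤ R` distinct rows for every bipartition has no rainbow
  (pairwise non-exchangeable) coordinate set of more than `N(R)` elements; its conclusion is exactly «few types»
  (`rainbow_card_le_of_colouring`); sparse indicators show `N(R) ≥ 2^(R−1)` is necessary.
The p-free counting lemma `lonely_le_of_rainbow` (a maximum rainbow subset of the lonely set dominates it) turns a rainbow bound into
the Partners shape without using transitivity of exchangeability.

Tree twin, part F (addendum) of the decomp-qadv lens-6 g23 node «TransferDial» (`g23/SliceDial.lean`, declaration bodies verbatim,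
namespace `…Theses.SliceDial` ↦ `…Theorems.TransferDial`; `Sw`, `PartnersAt`, `PartnersTwoOdd`, `StructureLawTwoOdd`, `sw_symm` are the
part C / D declarations).  0 sorry; no `instance`, no `notation`, no `native_decide`.
-/

set_option autoImplicit false
set_option linter.dupNamespace false

namespace Summit.QuantumAdvantage.QuantumAdvantage.Theorems.TransferDial

open Classical
open Finset
open Summit.QuantumAdvantage.AdviceFreeQNC0
open Literature.Computability.MetaComplexity Literature.Computability.MetaComplexity.Smolensky

/-! ## §1 Rows, slice counts, rainbows (typed) -/

/-- The ROW of `a` for the bipartition `(S, Sᶜ)`: the cut `u ↦ f(a on S, u off S)` (only `a|_S` and `u|_{Sᶜ}` matter). -/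
def rowOf {m : ℕ} (f : (Fin m → Bool) → Bool) (S : Finset (Fin m)) (a : Fin m → Bool) : (Fin m → Bool) → Bool :=
  fun u => f (fun i => if i ∈ S then a i else u i)

/-- The number of DISTINCT rows of `f` for the bipartition `(S, Sᶜ)` (= number of distinct subfunctions of `f` on `Sᶜ` obtained by fixing `S`;
over a finite field, `log_p` of it and the `𝔽_p`-rank of the communication matrix bound each other). -/
noncomputable def rowCount {m : ℕ} (f : (Fin m → Bool) → Bool) (S : Finset (Fin m)) : ℕ :=
  ((univ : Finset (Fin m → Bool)).image (rowOf f S)).card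

/-- SLICE-FEW at degree `d` with row budget `R`: every cut of `𝔽_p`-degree `≤ d` has `≤ R` distinct rows for EVERY bipartition. -/
def SliceFewAt (p : ℕ) [Fact p.Prime] (d R : ℕ) : Prop :=
  ∀ (m : ℕ) (f : (Fin m → Bool) → Bool), HasDegF p f d → ∀ S : Finset (Fin m), rowCount f S ≤ R

/-- ★ PIECE S (ALGEBRAIC, OPEN): `SliceFewTwoOdd` — at degree `≤ 2p − 3` the row count is bounded by `R(p)` uniformly in `m`, `f`, `S`.
Implied by B (`sliceFew_of_structureLaw`, `R = p^K`); FALSE at degree `2p − 2` (generic quadratic character). -/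
def SliceFewTwoOdd : Prop := ∀ (p : ℕ) [Fact p.Prime], 5 ≤ p → ∃ R : ℕ, SliceFewAt p (2 * p - 3) R

/-- A RAINBOW set of coordinates: pairwise NON-exchangeable. (`#classes ≤ N ⟺ every rainbow set has ≤ N elements`.) -/
def Rainbow {m : ℕ} (f : (Fin m → Bool) → Bool) (Y : Finset (Fin m)) : Prop :=
  ∀ i ∈ Y, ∀ j ∈ Y, i ≠ j → ¬ Sw f i j

/-- ★ PIECE C (PURE COMBINATORICS, p-FREE, OPEN): `RainbowBound` — a Boolean function with `≤ R` distinct rows for EVERY bipartition of its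
coordinates has no rainbow set of more than `N(R)` coordinates.  No prime, no degree: quantifies over ALL `f : {0,1}^m → {0,1}`. -/
def RainbowBound : Prop :=
  ∀ R : ℕ, ∃ N : ℕ, ∀ (m : ℕ) (f : (Fin m → Bool) → Bool), (∀ S : Finset (Fin m), rowCount f S ≤ R) →
    ∀ Y : Finset (Fin m), Rainbow f Y → Y.card ≤ N

/-! ## §2 The glue `Partners ⟸ SliceFew ∧ RainbowBound` (kernel) -/

section Glue
variable {m : ℕ} (f : (Fin m → Bool) → Bool)

/-- The exchange partners of `i`. -/
noncomputable def partners (i : Fin m) : Finset (Fin m) := univ.filter fun j : Fin m => j ≠ i ∧ Sw f i j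

/-- Extending a rainbow set by a coordinate exchangeable with none of its members keeps it rainbow. -/
theorem rainbow_insert {Y : Finset (Fin m)} {i : Fin m} (hY : Rainbow f Y) (hi : ∀ y ∈ Y, y ≠ i → ¬ Sw f y i) :
    Rainbow f (insert i Y) := by
  intro a ha b hb hab
  rcases mem_insert.1 ha with rfl | ha'
  · rcases mem_insert.1 hb with rfl | hb'
    · exact absurd rfl hab
    · exact fun h => hi b hb' (Ne.symm hab) (sw_symm f h)
  · rcases mem_insert.1 hb with rfl | hb'
    · exact hi a ha' hab
    · exact hY a ha' b hb' hab

/-- ★ LONELY COORDINATES ARE FEW, from a rainbow bound (p-free counting; no transitivity of `Sw` needed): if every rainbow set of `f` has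
`≤ N` elements then all but `≤ N · t` coordinates have `≥ t` exchange partners.  Proof: a maximum rainbow subset `Y₀` of the lonely set `L`
dominates `L` (maximality), and each `y ∈ Y₀` dominates `≤ t` lonely coordinates (itself and its `< t` partners). -/
theorem lonely_le_of_rainbow (N t : ℕ) (hN : ∀ Y : Finset (Fin m), Rainbow f Y → Y.card ≤ N) :
    ∃ L : Finset (Fin m), L.card ≤ N * t ∧ ∀ i ∉ L, t ≤ (partners f i).card := by
  set L : Finset (Fin m) := univ.filter fun i : Fin m => (partners f i).card < t with hL
  refine ⟨L, ?_, fun i hi => not_lt.1 fun hlt => hi (by rw [hL, mem_filter]; exact ⟨mem_univ _, hlt⟩)⟩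
  -- a rainbow subset of `L` of maximum cardinality
  set fam : Finset (Finset (Fin m)) := L.powerset.filter fun Y => Rainbow f Y with hfam
  have hne : fam.Nonempty := ⟨∅, by
    rw [hfam, mem_filter]; exact ⟨empty_mem_powerset _, fun a ha => absurd ha (by simp)⟩⟩
  obtain ⟨Y₀, hY₀fam, hmax⟩ := exists_max_image fam Finset.card hne
  rw [hfam, mem_filter, mem_powerset] at hY₀fam
  obtain ⟨hY₀L, hY₀R⟩ := hY₀fam
  -- every lonely coordinate is in `Y₀` or exchangeable with a member of `Y₀`
  have hdom : ∀ i ∈ L, i ∈ Y₀ ∨ ∃ y ∈ Y₀, y ≠ i ∧ Sw f y i := by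
    intro i hiL
    by_cases hiY : i ∈ Y₀
    · exact Or.inl hiY
    right
    by_contra hno
    have hR : Rainbow f (insert i Y₀) := rainbow_insert f hY₀R fun y hy hyi hsw => hno ⟨y, hy, hyi, hsw⟩
    have hmem : insert i Y₀ ∈ fam := by
      rw [hfam, mem_filter, mem_powerset]
      exact ⟨insert_subset hiL hY₀L, hR⟩
    have := hmax _ hmem
    rw [card_insert_of_notMem hiY] at this
    omega
  -- hence `L ⊆ ⋃_{y ∈ Y₀} ({y} ∪ partners y)`
  have hcov : L ⊆ Y₀.biUnion fun y => insert y (partners f y) := by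
    intro i hiL
    rw [mem_biUnion]
    rcases hdom i hiL with hiY | ⟨y, hy, hyi, hsw⟩
    · exact ⟨i, hiY, mem_insert_self _ _⟩
    · exact ⟨y, hy, mem_insert.2 (Or.inr (by rw [partners, mem_filter]; exact ⟨mem_univ _, hyi.symm, hsw⟩))⟩
  calc L.card ≤ (Y₀.biUnion fun y => insert y (partners f y)).card := card_le_card hcov
    _ ≤ ∑ y ∈ Y₀, (insert y (partners f y)).card := card_biUnion_le
    _ ≤ ∑ _y ∈ Y₀, t := sum_le_sum fun y hy => by
        have hyL : y ∈ L := hY₀L hy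
        rw [hL, mem_filter] at hyL
        exact (card_insert_le _ _).trans (by omega)
    _ = Y₀.card * t := by rw [sum_const, smul_eq_mul]
    _ ≤ N * t := Nat.mul_le_mul_right _ (hN Y₀ hY₀R)

end Glue

/-- ★ THE CARVING (kernel): `PartnersTwoOdd ⟸ SliceFewTwoOdd ∧ RainbowBound`, exception budget `N(R(p)) · (3p − 2)`. -/
theorem partners_of_sliceFew_rainbow (hS : SliceFewTwoOdd) (hC : RainbowBound) : PartnersTwoOdd := by
  intro p _ hp
  obtain ⟨R, hR⟩ := hS p hp
  obtain ⟨N, hN⟩ := hC R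
  refine ⟨N * (3 * p - 2), fun m f hf => ?_⟩
  obtain ⟨L, hLc, hLp⟩ := lonely_le_of_rainbow f N (3 * p - 2) fun Y hY => hN m f (hR m f hf) Y hY
  exact ⟨L, hLc, fun i hi => hLp i hi⟩

/-! ## §3 Exactness lemmas (kernel): `B ⟹ SliceFew` (so piece S is implied by the target) and `FewTypes ⟹` the conclusion of piece C -/

section Exact
variable {p : ℕ} [Fact p.Prime]

/-- Rows of a function of `K` linear forms are indexed by the `S`-part of the form vector: `rowCount ≤ p^K` (pointwise, any `S`). -/
theorem rowCount_le_of_forms {m K : ℕ} (f : (Fin m → Bool) → Bool) (lam : Fin K → Fin m → ZMod p) (F : (Fin K → ZMod p) → Bool)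
    (hF : ∀ u, f u = F (fun j => ∑ i, if u i = true then lam j i else 0)) (S : Finset (Fin m)) :
    rowCount f S ≤ p ^ K := by
  -- `rowOf f S a = g (xS a)` with `xS a ∈ 𝔽_p^K`
  let xS : (Fin m → Bool) → (Fin K → ZMod p) := fun a j => ∑ i, if i ∈ S ∧ a i = true then lam j i else 0
  let g : (Fin K → ZMod p) → ((Fin m → Bool) → Bool) :=
    fun z u => F (fun j => z j + ∑ i, if i ∉ S ∧ u i = true then lam j i else 0)
  have hrow : ∀ a, rowOf f S a = g (xS a) := by
    intro a
    funext u
    show f _ = F _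
    rw [hF]
    congr 1
    funext j
    show (∑ i, if (if i ∈ S then a i else u i) = true then lam j i else 0) =
      (∑ i, if i ∈ S ∧ a i = true then lam j i else 0) + ∑ i, if i ∉ S ∧ u i = true then lam j i else 0
    rw [← sum_add_distrib]
    refine sum_congr rfl fun i _ => ?_
    by_cases hi : i ∈ S
    · by_cases ha : a i = true <;> simp [hi, ha]
    · by_cases hu : u i = true <;> simp [hi, hu]
  have himg : (univ : Finset (Fin m → Bool)).image (rowOf f S) = ((univ : Finset (Fin m → Bool)).image xS).image g := by
    rw [image_image]
    exact image_congr fun a _ => hrow a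
  calc rowCount f S = (((univ : Finset (Fin m → Bool)).image xS).image g).card := by rw [rowCount, himg]
    _ ≤ ((univ : Finset (Fin m → Bool)).image xS).card := card_image_le
    _ ≤ (univ : Finset (Fin K → ZMod p)).card := card_le_univ _
    _ = p ^ K := by rw [card_univ, Fintype.card_fun, ZMod.card, Fintype.card_fin]

/-- ★ `B ⟹ SliceFewTwoOdd` with `R = p^K` (kernel): piece S is IMPLIED BY THE TARGET (no strength added). -/
theorem sliceFew_of_structureLaw (hB : StructureLawTwoOdd) : SliceFewTwoOdd := by
  intro p _ hp
  obtain ⟨K, hK⟩ := hB p hp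
  refine ⟨p ^ K, fun m f hf S => ?_⟩
  obtain ⟨lam, F, hF⟩ := hK m f hf
  exact rowCount_le_of_forms f lam F hF S

/-- A colouring with «same colour ⟹ exchangeable» (the shape of `TransferDial.FewTypesAt`) is injective on rainbow sets: `|Y| ≤ N`.
So the CONCLUSION of piece C is exactly «few types» (kernel). -/
theorem rainbow_card_le_of_colouring {m N : ℕ} (f : (Fin m → Bool) → Bool) (c : Fin m → Fin N)
    (hc : ∀ i j, c i = c j → Sw f i j) {Y : Finset (Fin m)} (hY : Rainbow f Y) : Y.card ≤ N := by
  have hinj : Set.InjOn c ↑Y := fun i hi j hj hij => by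
    by_contra hne
    exact hY i hi j hj hne (hc i j hij)
  calc Y.card = (Y.image c).card := (card_image_of_injOn hinj).symm
    _ ≤ (univ : Finset (Fin N)).card := card_le_univ _
    _ = N := by rw [card_univ, Fintype.card_fin]

/-- The monotonicity that Partners LACKS and rows HAVE: for `S ⊆ S'` the `S'`-row of `a` is a function of the `S`-row of `a` and of
`a` on `S' ∖ S` — fixing more coordinates can only MERGE rows (kernel; the one-line form refuters use). -/
theorem rowOf_mono {m : ℕ} (f : (Fin m → Bool) → Bool) {S S' : Finset (Fin m)} (hSS' : S ⊆ S') {a a' : Fin m → Bool}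
    (h : rowOf f S a = rowOf f S a') (hagree : ∀ i ∈ S', i ∉ S → a i = a' i) : rowOf f S' a = rowOf f S' a' := by
  funext u
  have e1 : rowOf f S' a u = rowOf f S a (fun i => if i ∈ S' then a i else u i) := by
    show f _ = f _
    congr 1
    funext i
    by_cases hi : i ∈ S
    · simp [hi, hSS' hi]
    · simp [hi]
  have e2 : rowOf f S' a' u = rowOf f S a' (fun i => if i ∈ S' then a i else u i) := by
    show f _ = f _
    congr 1
    funext i
    by_cases hi : i ∈ S
    · simp [hi, hSS' hi]
    · by_cases hi' : i ∈ S'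
      · simp [hi, hi', hagree i hi' hi]
      · simp [hi, hi']
  rw [e1, e2, h]

end Exact

/-! ## Axiom guards (standard axioms only) -/

/-- info: 'Summit.QuantumAdvantage.QuantumAdvantage.Theorems.TransferDial.lonely_le_of_rainbow' depends on axioms: [propext,
 choice,
 Quot.sound] -/
#guard_msgs in #print axioms lonely_le_of_rainbow
/-- info: 'Summit.QuantumAdvantage.QuantumAdvantage.Theorems.TransferDial.partners_of_sliceFew_rainbow' depends on axioms: [propext,
 choice,
 Quot.sound] -/
#guard_msgs in #print axioms partners_of_sliceFew_rainbow
/-- info: 'Summit.QuantumAdvantage.QuantumAdvantage.Theorems.TransferDial.rowCount_le_of_forms' depends on axioms: [propext,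
 choice,
 Quot.sound] -/
#guard_msgs in #print axioms rowCount_le_of_forms
/-- info: 'Summit.QuantumAdvantage.QuantumAdvantage.Theorems.TransferDial.sliceFew_of_structureLaw' depends on axioms: [propext,
 choice,
 Quot.sound] -/
#guard_msgs in #print axioms sliceFew_of_structureLaw
/-- info: 'Summit.QuantumAdvantage.QuantumAdvantage.Theorems.TransferDial.rainbow_card_le_of_colouring' depends on axioms: [propext,
 choice,
 Quot.sound] -/
#guard_msgs in #print axioms rainbow_card_le_of_colouring
/-- info: 'Summit.QuantumAdvantage.QuantumAdvantage.Theorems.TransferDial.rowOf_mono' depends on axioms: [propext, Quot.sound] -/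
#guard_msgs in #print axioms rowOf_mono

end Summit.QuantumAdvantage.QuantumAdvantage.Theorems.TransferDial
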